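import Summits.Langlands.Langlands.Theorems.RationalPeriodQuarterRationalDescentPrelim

/-!
# Rigidity tools for `AnalyticCore` — child 2 of the lens-1-g38 split of `RationalPeriodQuarter.SemiAnalyticRigidity`

(decomp-langlands node `SemiAnalyticRigiditySplit`, split of stmt-Langlands-2806.)  The workhorse of the analytic
core is RIGIDITY OF RATIONAL IDENTITIES ALONG AN INTERVAL: if `g` is real-analytic on a preconnected set `I ⊆ ℝ`
and agrees near one point of `I` with a fraction `A/B` (`A, B ∈ ℂ[X]` without common root), then `B` has no zero on
`I` and `g = A/B` on all of `I` — proved by the identity theorem applied to `B·g` and `A` (no division).  Plus: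
analyticity of `t ↦ P(t)` along `ℝ → ℂ`, polynomial identities from agreement near a point, full neighbourhoods
inside one-sided ones, local finiteness ⇒ finiteness on compacts, and analyticity of piecewise-rational functions
off their break set.  Mathlib + the `RationalDescent` preliminaries (for `ratDescent_remove_common_roots`,
`tameDecomp_*`).
-/

set_option linter.dupNamespace false

namespace Summit.Langlands.Langlands.Theorems

open Filter Set Topology Polynomial

/-- `t ↦ P(t)` (`P ∈ ℂ[X]`, `t` real) is real-analytic. -/
theorem anCore_analyticAt_evalC (P : ℂ[X]) (x : ℝ) : AnalyticAt ℝ (fun t : ℝ => P.eval (t : ℂ)) x := by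
  have h := (Complex.ofRealCLM.analyticAt x).aeval_polynomial P
  simp only [Complex.ofRealCLM_apply, Polynomial.coe_aeval_eq_eval] at h
  exact h

/-- A fraction `P/Q` is real-analytic at a point where `Q` does not vanish. -/
theorem anCore_analyticAt_frac (P Q : ℂ[X]) (x : ℝ) (hQ : Q.eval (x : ℂ) ≠ 0) :
    AnalyticAt ℝ (fun t : ℝ => P.eval (t : ℂ) / Q.eval (t : ℂ)) x :=
  (anCore_analyticAt_evalC P x).div (anCore_analyticAt_evalC Q x) hQ

/-- RIGIDITY.  `g` analytic on a preconnected `I`, equal near `y ∈ I` to `A/B` with `A, B` without common root: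
then `B ≠ 0` on `I` and `g = A/B` on `I`. -/
theorem anCore_rigid (g : ℝ → ℂ) (I : Set ℝ) (hI : IsPreconnected I) (hg : ∀ x ∈ I, AnalyticAt ℝ g x)
    (A B : ℂ[X]) (hno : ∀ β : ℂ, ¬ (A.IsRoot β ∧ B.IsRoot β)) (y : ℝ) (hy : y ∈ I)
    (heq : ∀ᶠ (t : ℝ) in 𝓝 y, B.eval (t : ℂ) ≠ 0 ∧ g t = A.eval (t : ℂ) / B.eval (t : ℂ)) :
    ∀ t ∈ I, B.eval (t : ℂ) ≠ 0 ∧ g t = A.eval (t : ℂ) / B.eval (t : ℂ) := by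
  have h1 : AnalyticOnNhd ℝ (fun t : ℝ => B.eval (t : ℂ) * g t) I := fun x hx =>
    (anCore_analyticAt_evalC B x).mul (hg x hx)
  have h2 : AnalyticOnNhd ℝ (fun t : ℝ => A.eval (t : ℂ)) I := fun x _ => anCore_analyticAt_evalC A x
  have heq' : (fun t : ℝ => B.eval (t : ℂ) * g t) =ᶠ[𝓝 y] fun t : ℝ => A.eval (t : ℂ) := by
    filter_upwards [heq] with t ht
    rw [ht.2, mul_div_cancel₀ _ ht.1]
  have hEq := h1.eqOn_of_preconnected_of_eventuallyEq h2 hI hy heq'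
  intro t ht
  have hBt : B.eval (t : ℂ) * g t = A.eval (t : ℂ) := hEq ht
  have hB : B.eval (t : ℂ) ≠ 0 := by
    intro h0
    have hA : A.eval (t : ℂ) = 0 := by rw [← hBt, h0, zero_mul]
    exact hno (t : ℂ) ⟨hA, h0⟩
  exact ⟨hB, by rw [eq_div_iff hB, mul_comm]; exact hBt⟩

/-- Two fractions agreeing near a real point are equal as cross-multiplied polynomials. -/
theorem anCore_cross_eq_of_eventually (A B A' B' : ℂ[X]) (y : ℝ)
    (h : ∀ᶠ (t : ℝ) in 𝓝 y, B.eval (t : ℂ) ≠ 0 ∧ B'.eval (t : ℂ) ≠ 0 ∧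
      A.eval (t : ℂ) / B.eval (t : ℂ) = A'.eval (t : ℂ) / B'.eval (t : ℂ)) :
    A * B' = A' * B := by
  apply Polynomial.eq_of_infinite_eval_eq
  obtain ⟨ε, hε, hball⟩ := Metric.eventually_nhds_iff.1 h
  have hsub : ((fun t : ℝ => (t : ℂ)) '' Set.Ioo y (y + ε)) ⊆
      {x : ℂ | eval x (A * B') = eval x (A' * B)} := by
    rintro _ ⟨t, ht, rfl⟩
    have hd : dist t y < ε := by
      rw [Real.dist_eq, abs_lt]; constructor <;> linarith [ht.1, ht.2]
    obtain ⟨hB, hB', hq⟩ := hball hd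
    rw [div_eq_div_iff hB hB'] at hq
    simp only [Set.mem_setOf_eq, Polynomial.eval_mul]
    linear_combination hq
  exact Set.Infinite.mono hsub ((Set.Ioo_infinite (by linarith)).image Complex.ofReal_injective.injOn)

/-- Inside a right-neighbourhood statement there is a point with a full-neighbourhood statement, as close as we
like. -/
theorem anCore_exists_nhds_of_nhdsGT {p : ℝ → Prop} {y : ℝ} (h : ∀ᶠ (t : ℝ) in 𝓝[>] y, p t) {ε : ℝ}
    (hε : 0 < ε) : ∃ y' : ℝ, y < y' ∧ y' < y + ε ∧ ∀ᶠ (t : ℝ) in 𝓝 y', p t := by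
  obtain ⟨u, hu, hsub⟩ := mem_nhdsGT_iff_exists_Ioo_subset.1 h
  have hyu : y < u := hu
  refine ⟨(y + min u (y + ε)) / 2, by
    have := lt_min hyu (by linarith : y < y + ε); linarith, by
    have := min_le_right u (y + ε); linarith, ?_⟩
  have hmem : (y + min u (y + ε)) / 2 ∈ Set.Ioo y u := by
    constructor
    · have := lt_min hyu (by linarith : y < y + ε); linarith
    · have := min_le_left u (y + ε); linarith
  filter_upwards [isOpen_Ioo.mem_nhds hmem] with t ht using hsub ht

/-- Same on the left. -/
theorem anCore_exists_nhds_of_nhdsLT {p : ℝ → Prop} {y : ℝ} (h : ∀ᶠ (t : ℝ) in 𝓝[<] y, p t) {ε : ℝ}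
    (hε : 0 < ε) : ∃ y' : ℝ, y' < y ∧ y - ε < y' ∧ ∀ᶠ (t : ℝ) in 𝓝 y', p t := by
  obtain ⟨l, hl, hsub⟩ := mem_nhdsLT_iff_exists_Ioo_subset.1 h
  have hly : l < y := hl
  refine ⟨(y + max l (y - ε)) / 2, by
    have := max_lt hly (by linarith : y - ε < y); linarith, by
    have := le_max_right l (y - ε); linarith, ?_⟩
  have hmem : (y + max l (y - ε)) / 2 ∈ Set.Ioo l y := by
    constructor
    · have := le_max_left l (y - ε); linarith
    · have := max_lt hly (by linarith : y - ε < y); linarith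
  filter_upwards [isOpen_Ioo.mem_nhds hmem] with t ht using hsub ht

/-- Inside a punctured-neighbourhood statement there is a nearby point with a full-neighbourhood statement. -/
theorem anCore_exists_nhds_of_nhdsNE {p : ℝ → Prop} {y : ℝ} (h : ∀ᶠ (t : ℝ) in 𝓝[≠] y, p t) {ε : ℝ}
    (hε : 0 < ε) : ∃ y' : ℝ, y' ≠ y ∧ |y' - y| < ε ∧ ∀ᶠ (t : ℝ) in 𝓝 y', p t := by
  obtain ⟨y', h1, h2, h3⟩ := anCore_exists_nhds_of_nhdsGT (h.filter_mono (nhdsGT_le_nhdsNE y)) hε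
  exact ⟨y', ne_of_gt h1, by rw [abs_lt]; constructor <;> linarith, h3⟩

/-- A set avoided by a punctured neighbourhood of every point meets every compact set in a finite set. -/
theorem anCore_finite_inter_compact (S K : Set ℝ) (hK : IsCompact K)
    (h : ∀ x : ℝ, ∀ᶠ (t : ℝ) in 𝓝[≠] x, t ∉ S) : (S ∩ K).Finite := by
  classical
  have hU : ∀ x ∈ K, {t : ℝ | t = x ∨ t ∉ S} ∈ 𝓝 x := by
    intro x _
    have := eventually_nhdsWithin_iff.1 (h x)
    filter_upwards [this] with t ht
    by_cases htx : t = x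
    · exact Or.inl htx
    · exact Or.inr (ht htx)
  obtain ⟨F, -, hcover⟩ := hK.elim_nhds_subcover (fun x => {t : ℝ | t = x ∨ t ∉ S}) hU
  refine (F.finite_toSet).subset fun s hs => ?_
  obtain ⟨hsS, hsK⟩ := hs
  have := hcover hsK
  simp only [Set.mem_iUnion, Set.mem_setOf_eq] at this
  obtain ⟨x, hx, hsx⟩ := this
  rcases hsx with rfl | hns
  · exact hx
  · exact absurd hsS hns

/-- From punctured-local agreement everywhere plus cofinite agreement on both tails to cofinite agreement. -/
theorem anCore_cofinite_of_local (k₁ k₂ : ℝ → ℂ) (R : ℝ)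
    (hloc : ∀ x : ℝ, ∀ᶠ (t : ℝ) in 𝓝[≠] x, k₁ t = k₂ t)
    (htail : ∀ᶠ t in Filter.cofinite, (R < t ∨ t < -R) → k₁ t = k₂ t) :
    ∀ᶠ t in Filter.cofinite, k₁ t = k₂ t := by
  have hfin := anCore_finite_inter_compact {t | k₁ t ≠ k₂ t} (Set.Icc (-R) R) isCompact_Icc
    (fun x => (hloc x).mono fun t ht hmem => hmem ht)
  rw [Filter.eventually_cofinite] at htail ⊢
  refine (hfin.union htail).subset fun t ht => ?_
  by_cases hR : R < t ∨ t < -R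
  · exact Or.inr fun himp => ht (himp hR)
  · push Not at hR
    exact Or.inl ⟨ht, hR.2, hR.1⟩

/-- A piecewise-rational function (local fractions off a finite set) is real-analytic off that set. -/
theorem anCore_analyticAt_of_local_frac (ρ : ℝ → ℂ) (x : ℝ) (P Q : ℂ[X])
    (h : ∀ᶠ (t : ℝ) in 𝓝 x, Q.eval (t : ℂ) ≠ 0 ∧ ρ t = P.eval (t : ℂ) / Q.eval (t : ℂ)) :
    AnalyticAt ℝ ρ x := by
  have hQ : Q.eval (x : ℂ) ≠ 0 := (h.self_of_nhds).1
  refine (anCore_analyticAt_frac P Q x hQ).congr ?_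
  filter_upwards [h] with t ht using ht.2.symm

end Summit.Langlands.Langlands.Theorems
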